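import Mathlib

/-!
# Lattice (Siegel-type) elimination criterion — fam-elim E-L4

Target in tree: `Summits/KontsevichZagierPeriods/Zeta5Search/Elimination/LatticeCriterion.lean`.

HONEST FRAMING: systematic search; no irrationality claim unless certified.

This file types the criterion behind fam-elim `FAMILY.md` §15 (the "lattice road"; designer item
P6(iii) re-opened).  Data: three linear forms `r i = u i * ξ + w i * η + v i` (think `ξ = ζ(5)`,
`η = ζ(3)`) with rational coefficient vectors of rank 3.  An INTEGER RELATION `α ⊥ w` whose images
`A = Σ αᵢ uᵢ`, `B = Σ αᵢ vᵢ` are integers turns the three forms into ONE integer form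
`A ξ + B = Σ αᵢ rᵢ` from which `η` has been eliminated (`elim_value`).  Rank 3 forces two linearly
independent relations to give two independent integer pairs (`pairs_independent_of_rank_three`), and
two independent integer pairs that are both `< 1/q`-small for every `q` force `ξ ∉ ℚ`
(`irrational_of_two_independent_small_pairs`).  The assembled statement is
`irrational_of_lattice_elimination`.

What is NOT here (and is not claimed anywhere): that such pairs of short relations EXIST for the
Brown–Zudilin / Zudilin coefficient triples.  That is the open lattice hypothesis `H(τ*)` of
`FAMILY.md` §15 (numerically observed with large margins, not proved, and — as recorded there —
not provable by any tool of the cell).  This file is the certificate FORMAT for that road, no more.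
-/

namespace Summit.KontsevichZagierPeriods.Zeta5Search.Elimination

open Finset

/-- An integer whose real absolute value is `< 1` is zero. -/
theorem int_eq_zero_of_abs_lt_one {z : ℤ} (h : |(z : ℝ)| < 1) : z = 0 := by
  have h' : |z| < 1 := by exact_mod_cast h
  exact Int.abs_lt_one_iff.mp h'

/-- If `ξ = p/q` with `q > 0` and `|A ξ + B| < 1/q`, then the integer `A p + B q` vanishes. -/
theorem pair_annihilates_of_small {ξ : ℝ} {p q : ℤ} (hq : 0 < q) (hξ : ξ = (p : ℝ) / (q : ℝ))
    {A B : ℤ} (h : |(A : ℝ) * ξ + B| < 1 / (q : ℝ)) : A * p + B * q = 0 := by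
  have hq' : (0 : ℝ) < q := by exact_mod_cast hq
  have hqne : (q : ℝ) ≠ 0 := ne_of_gt hq'
  apply int_eq_zero_of_abs_lt_one
  have key : ((A * p + B * q : ℤ) : ℝ) = ((A : ℝ) * ξ + B) * q := by
    rw [hξ]; push_cast; field_simp
  have h2 : |(A : ℝ) * ξ + B| * (q : ℝ) < 1 := by
    have := (lt_div_iff₀ hq').mp h
    simpa using this
  rw [key, abs_mul, abs_of_pos hq']
  exact h2

/-- **Two-pair criterion.** If for every positive integer `q` there are two integer pairs with
non-vanishing determinant whose forms in `ξ` are both `< 1/q`, then `ξ` is irrational. -/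
theorem irrational_of_two_independent_small_pairs (ξ : ℝ)
    (h : ∀ q : ℕ, 0 < q → ∃ A₁ B₁ A₂ B₂ : ℤ, A₁ * B₂ ≠ A₂ * B₁ ∧
      |(A₁ : ℝ) * ξ + B₁| < 1 / (q : ℝ) ∧ |(A₂ : ℝ) * ξ + B₂| < 1 / (q : ℝ)) :
    Irrational ξ := by
  rintro ⟨r, hr⟩
  obtain ⟨A₁, B₁, A₂, B₂, hdet, h₁, h₂⟩ := h r.den r.den_pos
  have hξ : ξ = (r.num : ℝ) / ((r.den : ℤ) : ℝ) := by
    rw [← hr, Rat.cast_def]; push_cast; rfl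
  have hq : (0 : ℤ) < (r.den : ℤ) := by exact_mod_cast r.den_pos
  have h₁' : |(A₁ : ℝ) * ξ + B₁| < 1 / ((r.den : ℤ) : ℝ) := by simpa using h₁
  have h₂' : |(A₂ : ℝ) * ξ + B₂| < 1 / ((r.den : ℤ) : ℝ) := by simpa using h₂
  have e₁ := pair_annihilates_of_small hq hξ h₁'
  have e₂ := pair_annihilates_of_small hq hξ h₂'
  have hmul : (r.den : ℤ) * (A₁ * B₂ - A₂ * B₁) = 0 := by
    linear_combination A₁ * e₂ - A₂ * e₁
  rcases mul_eq_zero.mp hmul with hden | hzero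
  · exact absurd hden (ne_of_gt hq)
  · exact hdet (sub_eq_zero.mp hzero)

/-- Value of the eliminated form: if `α ⊥ w` then `Σ αᵢ rᵢ = A ξ + B` with `A = Σ αᵢ uᵢ`,
`B = Σ αᵢ vᵢ` — the coefficient of `η` is gone. -/
theorem elim_value (ξ η : ℝ) (u w v : Fin 3 → ℚ) (α : Fin 3 → ℚ)
    (hw : ∑ i, α i * w i = 0) :
    ∑ i, (α i : ℝ) * ((u i : ℝ) * ξ + (w i : ℝ) * η + (v i : ℝ))
      = ((∑ i, α i * u i : ℚ) : ℝ) * ξ + ((∑ i, α i * v i : ℚ) : ℝ) := by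
  simp only [Fin.sum_univ_three] at hw ⊢
  have hw' : (α 0 : ℝ) * (w 0 : ℝ) + (α 1 : ℝ) * (w 1 : ℝ) + (α 2 : ℝ) * (w 2 : ℝ) = 0 := by
    exact_mod_cast hw
  push_cast
  linear_combination η * hw'

/-- Linear combinations pass through the three coordinate functionals. -/
theorem sum_comb (s t : ℚ) (α β x : Fin 3 → ℚ) :
    ∑ i, (s • α - t • β) i * x i = s * ∑ i, α i * x i - t * ∑ i, β i * x i := by
  simp only [Pi.sub_apply, Pi.smul_apply, smul_eq_mul, Finset.mul_sum, ← Finset.sum_sub_distrib]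
  refine Finset.sum_congr rfl ?_
  intro i _
  ring

/-- **Independence of the two pairs.** If `a ↦ (Σ aᵢuᵢ, Σ aᵢwᵢ, Σ aᵢvᵢ)` is injective (the three
forms have rank 3) and `α, β ⊥ w` are linearly independent, then the integer pairs
`(A_α, B_α)` and `(A_β, B_β)` have non-zero determinant. -/
theorem pairs_independent_of_rank_three (u w v : Fin 3 → ℚ)
    (hrank : ∀ a : Fin 3 → ℚ,
      ∑ i, a i * u i = 0 → ∑ i, a i * w i = 0 → ∑ i, a i * v i = 0 → a = 0)
    (α β : Fin 3 → ℚ) (hα : ∑ i, α i * w i = 0) (hβ : ∑ i, β i * w i = 0)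
    (hind : ∀ s t : ℚ, s • α = t • β → s = 0 ∧ t = 0) :
    (∑ i, α i * u i) * (∑ i, β i * v i) ≠ (∑ i, β i * u i) * (∑ i, α i * v i) := by
  intro hdet
  -- a non-zero pair (s,t) with s•α - t•β in the kernel of the three functionals
  have kernel : ∀ s t : ℚ,
      s * (∑ i, α i * u i) - t * (∑ i, β i * u i) = 0 →
      s * (∑ i, α i * v i) - t * (∑ i, β i * v i) = 0 → s = 0 ∧ t = 0 := by
    intro s t hu hv
    have hz : s • α - t • β = 0 := by
      apply hrank
      · rw [sum_comb]; exact hu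
      · rw [sum_comb, hα, hβ]; ring
      · rw [sum_comb]; exact hv
    exact hind s t (sub_eq_zero.mp hz)
  by_cases hA : (∑ i, α i * u i) = 0 ∧ (∑ i, β i * u i) = 0
  · by_cases hB : (∑ i, α i * v i) = 0 ∧ (∑ i, β i * v i) = 0
    · -- then α itself is in the kernel, hence zero, contradicting independence (s,t) = (1,0)
      have h10 := kernel 1 0 (by rw [hA.1]; ring) (by rw [hB.1]; ring)
      exact one_ne_zero h10.1
    · -- (s,t) = (B_β, B_α)
      have hst := kernel (∑ i, β i * v i) (∑ i, α i * v i)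
        (by rw [hA.1, hA.2]; ring) (by ring)
      apply hB
      exact ⟨hst.2, hst.1⟩
  · -- (s,t) = (A_β, A_α), using the determinant relation for the v-coordinate
    have hst := kernel (∑ i, β i * u i) (∑ i, α i * u i) (by ring)
      (by linear_combination (-1 : ℚ) * hdet)
    apply hA
    exact ⟨hst.2, hst.1⟩

/-- **Lattice elimination criterion (assembled, rank checked at the chosen index).** A sequence of coefficient
triples `(u n, w n, v n)` and, for every `q`, an index `n` AT WHICH the triple has rank 3 (injectivity of
`a ↦ (Σ aᵢuᵢ, Σ aᵢwᵢ, Σ aᵢvᵢ)`) together with two linearly independent INTEGER relations `α, β ⊥ w n` whose `u`-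
and `v`-images are integers and whose eliminated forms are both `< 1/q`, forces `ξ` to be irrational (whatever
`η` is).  For the lattice road of `FAMILY.md` §15, `α, β` are the two successive minima of
`M_n = {α ∈ ℤ³ : α ⊥ w n, α·u n ∈ ℤ, α·v n ∈ ℤ}`; their existence with the required smallness is the OPEN
hypothesis, not part of this theorem. -/
theorem irrational_of_lattice_elimination (ξ η : ℝ) (u w v : ℕ → Fin 3 → ℚ)
    (h : ∀ q : ℕ, 0 < q → ∃ n : ℕ,
        (∀ a : Fin 3 → ℚ,
          ∑ i, a i * u n i = 0 → ∑ i, a i * w n i = 0 → ∑ i, a i * v n i = 0 → a = 0) ∧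
        ∃ α β : Fin 3 → ℤ,
        ∑ i, (α i : ℚ) * w n i = 0 ∧ ∑ i, (β i : ℚ) * w n i = 0 ∧
        (∀ s t : ℚ, s • (fun i => (α i : ℚ)) = t • (fun i => (β i : ℚ)) → s = 0 ∧ t = 0) ∧
        (∃ A B : ℤ, (A : ℚ) = ∑ i, (α i : ℚ) * u n i ∧ (B : ℚ) = ∑ i, (α i : ℚ) * v n i) ∧
        (∃ A B : ℤ, (A : ℚ) = ∑ i, (β i : ℚ) * u n i ∧ (B : ℚ) = ∑ i, (β i : ℚ) * v n i) ∧
        |∑ i, (α i : ℝ) * ((u n i : ℝ) * ξ + (w n i : ℝ) * η + (v n i : ℝ))| < 1 / (q : ℝ) ∧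
        |∑ i, (β i : ℝ) * ((u n i : ℝ) * ξ + (w n i : ℝ) * η + (v n i : ℝ))| < 1 / (q : ℝ)) :
    Irrational ξ := by
  apply irrational_of_two_independent_small_pairs
  intro q hq
  obtain ⟨n, hrank, α, β, hαw, hβw, hind, ⟨A₁, B₁, hA₁, hB₁⟩, ⟨A₂, B₂, hA₂, hB₂⟩, hsmallα, hsmallβ⟩ :=
    h q hq
  refine ⟨A₁, B₁, A₂, B₂, ?_, ?_, ?_⟩
  · -- independence of the pairs from rank 3
    have key := pairs_independent_of_rank_three (u n) (w n) (v n) hrank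
      (fun i => (α i : ℚ)) (fun i => (β i : ℚ)) hαw hβw hind
    intro hdet
    apply key
    have hdetQ : (A₁ : ℚ) * (B₂ : ℚ) = (A₂ : ℚ) * (B₁ : ℚ) := by exact_mod_cast hdet
    rw [hA₁, hB₂, hA₂, hB₁] at hdetQ
    simpa [mul_comm] using hdetQ
  · have hv := elim_value ξ η (u n) (w n) (v n) (fun i => (α i : ℚ)) hαw
    have hA₁' : ((∑ i, (α i : ℚ) * u n i : ℚ) : ℝ) = (A₁ : ℝ) := by rw [← hA₁]; push_cast; rfl
    have hB₁' : ((∑ i, (α i : ℚ) * v n i : ℚ) : ℝ) = (B₁ : ℝ) := by rw [← hB₁]; push_cast; rfl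
    have hcast : ∑ i, ((α i : ℚ) : ℝ) * ((u n i : ℝ) * ξ + (w n i : ℝ) * η + (v n i : ℝ))
        = ∑ i, (α i : ℝ) * ((u n i : ℝ) * ξ + (w n i : ℝ) * η + (v n i : ℝ)) := by
      push_cast; rfl
    rw [hcast] at hv
    rw [hv, hA₁', hB₁'] at hsmallα
    exact hsmallα
  · have hv := elim_value ξ η (u n) (w n) (v n) (fun i => (β i : ℚ)) hβw
    have hA₂' : ((∑ i, (β i : ℚ) * u n i : ℚ) : ℝ) = (A₂ : ℝ) := by rw [← hA₂]; push_cast; rfl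
    have hB₂' : ((∑ i, (β i : ℚ) * v n i : ℚ) : ℝ) = (B₂ : ℝ) := by rw [← hB₂]; push_cast; rfl
    have hcast : ∑ i, ((β i : ℚ) : ℝ) * ((u n i : ℝ) * ξ + (w n i : ℝ) * η + (v n i : ℝ))
        = ∑ i, (β i : ℝ) * ((u n i : ℝ) * ξ + (w n i : ℝ) * η + (v n i : ℝ)) := by
      push_cast; rfl
    rw [hcast] at hv
    rw [hv, hA₂', hB₂'] at hsmallβ
    exact hsmallβ

/-- The same with rank 3 assumed at EVERY index (the shape used when a uniform rank theorem is available). -/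
theorem irrational_of_lattice_elimination' (ξ η : ℝ) (u w v : ℕ → Fin 3 → ℚ)
    (hrank : ∀ n, ∀ a : Fin 3 → ℚ,
      ∑ i, a i * u n i = 0 → ∑ i, a i * w n i = 0 → ∑ i, a i * v n i = 0 → a = 0)
    (h : ∀ q : ℕ, 0 < q → ∃ n : ℕ, ∃ α β : Fin 3 → ℤ,
        ∑ i, (α i : ℚ) * w n i = 0 ∧ ∑ i, (β i : ℚ) * w n i = 0 ∧
        (∀ s t : ℚ, s • (fun i => (α i : ℚ)) = t • (fun i => (β i : ℚ)) → s = 0 ∧ t = 0) ∧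
        (∃ A B : ℤ, (A : ℚ) = ∑ i, (α i : ℚ) * u n i ∧ (B : ℚ) = ∑ i, (α i : ℚ) * v n i) ∧
        (∃ A B : ℤ, (A : ℚ) = ∑ i, (β i : ℚ) * u n i ∧ (B : ℚ) = ∑ i, (β i : ℚ) * v n i) ∧
        |∑ i, (α i : ℝ) * ((u n i : ℝ) * ξ + (w n i : ℝ) * η + (v n i : ℝ))| < 1 / (q : ℝ) ∧
        |∑ i, (β i : ℝ) * ((u n i : ℝ) * ξ + (w n i : ℝ) * η + (v n i : ℝ))| < 1 / (q : ℝ)) :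
    Irrational ξ :=
  irrational_of_lattice_elimination ξ η u w v fun q hq => by
    obtain ⟨n, hn⟩ := h q hq
    exact ⟨n, hrank n, hn⟩

/-- **Necessity side (trivial half of the dichotomy).** If `ξ = p/q` (`q > 0`), then EVERY integer
pair either annihilates `(p,q)` or has `|A ξ + B| ≥ 1/q`; in the lattice language: every vector of
`M_n` off one line has an eliminated form of size `≥ 1/q`. -/
theorem pair_dichotomy_of_rational {ξ : ℝ} {p q : ℤ} (hq : 0 < q) (hξ : ξ = (p : ℝ) / (q : ℝ))
    (A B : ℤ) : A * p + B * q = 0 ∨ 1 / (q : ℝ) ≤ |(A : ℝ) * ξ + B| := by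
  by_cases h : |(A : ℝ) * ξ + B| < 1 / (q : ℝ)
  · exact Or.inl (pair_annihilates_of_small hq hξ h)
  · exact Or.inr (not_lt.mp h)

end Summit.KontsevichZagierPeriods.Zeta5Search.Elimination
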